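import Mathlib.GroupTheory.DoubleCoset
import Mathlib.Tactic.Group
import Mathlib.CategoryTheory.Endomorphism
import Literature.AnabelianGeometry.SemiGraphs.SemiGraph
import HarnessLib

/-!
# The coset semi-graphs of a graph of groups presented inside a group ([SemiAnbd] §3 pp. 40–41, §5 p. 65)

Mochizuki, *Semi-graphs of anabelioids*, Publ. RIMS **42** (2006), §3 proof of Thm. 3.7 (iii) p. 41
("the projective system of connected finite étale Galois coverings … the semi-graphs `𝒢_{∞,i}` …
`𝔾_j`") and §5 p. 65 ("decomposition groups `Π^temp_{𝔊,v} ⊆ Π^temp_𝔊` … well-defined up to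
conjugation") [cite: MochizukiSemiAnbd2006, Thm 3.7(iii) p.41].

GROUP-THEORETIC MODEL used by the arithmetic tower of [SemiAnbd] Thm. 5.4 (cell row T54-B, tower
third; plan/GAP-LEDGER.md G-w4d053-1).  A *subgroup presentation* of a semi-graph `𝔾` inside a group
`Γ` is the datum, for every vertex `w`, of a subgroup `H_w ≤ Γ` (the verticial subgroup), for every
edge `e` of a subgroup `M_e ≤ Γ` (the edge subgroup) and, for every branch `b : e → w`, of an element
`s_b ∈ Γ` with `s_b M_e s_b⁻¹ ≤ H_w` (the branch inclusion).  For a subgroup `K ≤ Γ` (a "level") the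
*coset semi-graph* `P.cosetGraph K` has vertices over `w` the double cosets `H_w \ Γ / K`, edges over
`e` the double cosets `M_e \ Γ / K`, the branches of an edge-class over `e` the branches of `e`, the
branch over `b : e → w` of `M_e y K` abutting to `H_w s_b y K`.  When `Γ = π₁^temp(𝒢)` with its
verticial / edge-like subgroups and `K` is the open normal subgroup of a Galois tempered covering,
this is the underlying semi-graph of that covering (the dictionary is a separate file); here only the
combinatorics: the structure morphism to `𝔾`, the transition maps `K' ≤ K`, and the DECK action of
`Γ` by right translation for normal `K`.  Pure group theory over Mathlib; nothing here bears on
[IUTchIII] Cor. 3.12.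
-/

namespace Literature.AnabelianGeometry.SemiGraphs

namespace SemiGraph

open CategoryTheory

universe u

variable {𝔾 : SemiGraph.{u}} {Γ : Type u} [Group Γ]

/-- A **presentation of a graph of groups over `𝔾` inside the group `Γ`**: verticial subgroups
`H_w`, edge subgroups `M_e` and branch elements `s_b` conjugating `M_e` into `H_w` for `b : e → w`
(the shape of "`Π^temp_{𝔊,b} ⊆ Π^temp_{𝔊,v}` … well-defined up to conjugation", [SemiAnbd] p. 65).
[cite: MochizukiSemiAnbd2006, §5 p.65] -/
structure SubgroupPresentation (𝔾 : SemiGraph.{u}) (Γ : Type u) [Group Γ] : Type u where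
  /-- the verticial subgroup at the vertex `w` -/
  H : 𝔾.Vertex → Subgroup Γ
  /-- the edge subgroup of the edge `e` -/
  M : 𝔾.Edge → Subgroup Γ
  /-- the branch element of the branch `b` -/
  s : 𝔾.Branch → Γ
  /-- for `b : e → w`, conjugation by `s_b` carries `M_e` into `H_w` -/
  conj_mem : ∀ (b : 𝔾.Branch) (w : 𝔾.Vertex), 𝔾.abuts b = some w →
    ∀ m ∈ M (𝔾.edgeOf b), s b * m * (s b)⁻¹ ∈ H w

namespace SubgroupPresentation

variable (P : SubgroupPresentation 𝔾 Γ) (K : Subgroup Γ)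

/-- The vertex classes over `w` at level `K`: the double cosets `H_w \ Γ / K`.
[cite: MochizukiSemiAnbd2006, Thm 3.7(iii) p.41] -/
abbrev VClass (w : 𝔾.Vertex) : Type u := DoubleCoset.Quotient (P.H w : Set Γ) (K : Set Γ)

/-- The edge classes over `e` at level `K`: the double cosets `M_e \ Γ / K`.
[cite: MochizukiSemiAnbd2006, Thm 3.7(iii) p.41] -/
abbrev EClass (e : 𝔾.Edge) : Type u := DoubleCoset.Quotient (P.M e : Set Γ) (K : Set Γ)

/-- The abutment map of the branch `b : e → w` at level `K`: `M_e y K ↦ H_w s_b y K` (well defined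
because `s_b M_e s_b⁻¹ ≤ H_w`). [cite: MochizukiSemiAnbd2006, Thm 3.7(iii) p.41] -/
def brVertexMap (b : 𝔾.Branch) (w : 𝔾.Vertex) (hw : 𝔾.abuts b = some w) :
    P.EClass K (𝔾.edgeOf b) → P.VClass K w :=
  Quotient.map' (fun y => P.s b * y) (by
    intro y y' h
    obtain ⟨m, hm, k, hk, rfl⟩ := DoubleCoset.rel_iff.mp h
    refine DoubleCoset.rel_iff.mpr ⟨P.s b * m * (P.s b)⁻¹, P.conj_mem b w hw m hm, k, hk, ?_⟩
    group)

/-- `brVertexMap` on representatives. [cite: MochizukiSemiAnbd2006, Thm 3.7(iii) p.41] -/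
@[simp] theorem brVertexMap_mk (b : 𝔾.Branch) (w : 𝔾.Vertex) (hw : 𝔾.abuts b = some w) (y : Γ) :
    P.brVertexMap K b w hw (DoubleCoset.mk (P.M (𝔾.edgeOf b)) K y) =
      DoubleCoset.mk (P.H w) K (P.s b * y) := rfl

/-- **The coset semi-graph of the presentation `P` at level `K`** — vertices over `w` = `H_w \ Γ / K`,
edges over `e` = `M_e \ Γ / K`, the branches of an edge-class over `e` = the branches of `e`, the
branch over `b : e → w` of `M_e y K` abutting to `H_w s_b y K` (the shape of the underlying semi-graph
`𝔾_j` of a Galois covering, [SemiAnbd] p. 41). [cite: MochizukiSemiAnbd2006, Thm 3.7(iii) p.41] -/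
def cosetGraph : SemiGraph.{u} where
  Vertex := Σ w : 𝔾.Vertex, P.VClass K w
  Edge := Σ e : 𝔾.Edge, P.EClass K e
  Branch := {p : 𝔾.Branch × (Σ e : 𝔾.Edge, P.EClass K e) // p.2.1 = 𝔾.edgeOf p.1}
  edgeOf p := p.1.2
  abuts p := (𝔾.abuts p.1.1).pbind fun w hw =>
    some ⟨w, P.brVertexMap K p.1.1 w (Option.mem_def.mp hw) (p.2 ▸ p.1.2.2)⟩
  two_branches := by
    rintro ⟨e, q⟩
    obtain ⟨b₁, b₂, hne, h₁, h₂, hall⟩ := 𝔾.two_branches e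
    refine ⟨⟨(b₁, ⟨e, q⟩), h₁.symm⟩, ⟨(b₂, ⟨e, q⟩), h₂.symm⟩, ?_, rfl, rfl, ?_⟩
    · intro h
      exact hne (congrArg (fun p : {p : 𝔾.Branch × (Σ e : 𝔾.Edge, P.EClass K e) //
        p.2.1 = 𝔾.edgeOf p.1} => p.1.1) h)
    · rintro ⟨⟨b, E⟩, hE⟩ (hb : E = ⟨e, q⟩)
      have hbe : 𝔾.edgeOf b = e := by rw [hb] at hE; exact hE.symm
      rcases hall b hbe with h | h
      · exact Or.inl (Subtype.ext (Prod.ext h hb))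
      · exact Or.inr (Subtype.ext (Prod.ext h hb))

/-- The vertex of the coset semi-graph given by a vertex of `𝔾` and a representative.
[cite: MochizukiSemiAnbd2006, Thm 3.7(iii) p.41] -/
abbrev vMk (w : 𝔾.Vertex) (y : Γ) : (P.cosetGraph K).Vertex := ⟨w, DoubleCoset.mk (P.H w) K y⟩

/-- The edge of the coset semi-graph given by an edge of `𝔾` and a representative.
[cite: MochizukiSemiAnbd2006, Thm 3.7(iii) p.41] -/
abbrev eMk (e : 𝔾.Edge) (y : Γ) : (P.cosetGraph K).Edge := ⟨e, DoubleCoset.mk (P.M e) K y⟩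

/-- The branch of the coset semi-graph given by a branch of `𝔾` and a representative.
[cite: MochizukiSemiAnbd2006, Thm 3.7(iii) p.41] -/
abbrev bMk (b : 𝔾.Branch) (y : Γ) : (P.cosetGraph K).Branch :=
  ⟨(b, ⟨𝔾.edgeOf b, DoubleCoset.mk (P.M (𝔾.edgeOf b)) K y⟩), rfl⟩

/-- Every vertex of the coset semi-graph has a representative.
[cite: MochizukiSemiAnbd2006, Thm 3.7(iii) p.41] -/
theorem vMk_surjective : ∀ x : (P.cosetGraph K).Vertex, ∃ w y, x = P.vMk K w y := by
  rintro ⟨w, q⟩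
  induction q using Quotient.inductionOn' with
  | h y => exact ⟨w, y, rfl⟩

/-- Every edge of the coset semi-graph has a representative.
[cite: MochizukiSemiAnbd2006, Thm 3.7(iii) p.41] -/
theorem eMk_surjective : ∀ x : (P.cosetGraph K).Edge, ∃ e y, x = P.eMk K e y := by
  rintro ⟨e, q⟩
  induction q using Quotient.inductionOn' with
  | h y => exact ⟨e, y, rfl⟩

/-- Every branch of the coset semi-graph has a representative.
[cite: MochizukiSemiAnbd2006, Thm 3.7(iii) p.41] -/
theorem bMk_surjective : ∀ x : (P.cosetGraph K).Branch, ∃ b y, x = P.bMk K b y := by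
  rintro ⟨⟨b, e, q⟩, he⟩
  have he' : e = 𝔾.edgeOf b := he
  subst he'
  induction q using Quotient.inductionOn' with
  | h y => exact ⟨b, y, rfl⟩

/-- The coincidence map of the coset semi-graph on representatives, abutting branch.
[cite: MochizukiSemiAnbd2006, Thm 3.7(iii) p.41] -/
theorem cosetGraph_abuts_bMk (b : 𝔾.Branch) (w : 𝔾.Vertex) (hw : 𝔾.abuts b = some w) (y : Γ) :
    (P.cosetGraph K).abuts (P.bMk K b y) = some (P.vMk K w (P.s b * y)) := by
  change (𝔾.abuts b).pbind _ = _
  simp only [hw, Option.pbind_some]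
  rfl

/-- The coincidence map of the coset semi-graph on representatives, open branch.
[cite: MochizukiSemiAnbd2006, Thm 3.7(iii) p.41] -/
theorem cosetGraph_abuts_bMk_none (b : 𝔾.Branch) (hw : 𝔾.abuts b = none) (y : Γ) :
    (P.cosetGraph K).abuts (P.bMk K b y) = none := by
  change (𝔾.abuts b).pbind _ = _
  simp only [hw]
  rfl

/-- **The structure morphism `P.cosetGraph K ⟶ 𝔾`.** [cite: MochizukiSemiAnbd2006, Thm 3.7(iii) p.41] -/
def cosetGraphProj : P.cosetGraph K ⟶ 𝔾 where
  vertexMap x := x.1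
  edgeMap x := x.1
  branchMap p := p.1.1
  edgeOf_branchMap p := p.2.symm
  branchMap_injOn := by
    rintro ⟨⟨b₁, E₁⟩, h₁⟩ ⟨⟨b₂, E₂⟩, h₂⟩ (hE : E₁ = E₂) (hb : b₁ = b₂)
    subst hE; subst hb; rfl
  abuts_branchMap := by
    rintro ⟨⟨b, E⟩, hE⟩ ⟨w, q⟩ h
    change 𝔾.abuts b = some w
    change (𝔾.abuts b).pbind _ = _ at h
    rcases hab : 𝔾.abuts b with _ | w'
    · simp [hab] at h
    · simp only [hab, Option.pbind_some] at h
      exact congrArg some (Sigma.mk.inj_iff.mp (Option.some_injective _ h)).1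

/-- Two morphisms between coset semi-graphs agreeing on vertex, edge and branch representatives are
equal. [cite: MochizukiSemiAnbd2006, Thm 3.7(iii) p.41] -/
theorem hom_ext_mk {X : SemiGraph.{u}} (φ ψ : P.cosetGraph K ⟶ X)
    (hv : ∀ w y, φ.vertexMap (P.vMk K w y) = ψ.vertexMap (P.vMk K w y))
    (he : ∀ e y, φ.edgeMap (P.eMk K e y) = ψ.edgeMap (P.eMk K e y))
    (hb : ∀ b y, φ.branchMap (P.bMk K b y) = ψ.branchMap (P.bMk K b y)) : φ = ψ := by
  refine SemiGraph.hom_ext _ _ (funext fun x => ?_) (funext fun x => ?_) (funext fun x => ?_)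
  · obtain ⟨w, y, rfl⟩ := P.vMk_surjective K x; exact hv w y
  · obtain ⟨e, y, rfl⟩ := P.eMk_surjective K x; exact he e y
  · obtain ⟨b, y, rfl⟩ := P.bMk_surjective K x; exact hb b y

/-! ### Morphisms of coset semi-graphs from compatible maps on representatives -/

section Map

variable {P K} {P' : SubgroupPresentation 𝔾 Γ} {K' : Subgroup Γ}

/-- A map on representatives `y ↦ f y` inducing, for every vertex / edge, well-defined maps on the
double cosets of `P, K` into those of `P', K'` over the same vertex / edge of `𝔾`, and commuting with
the branch elements up to the target classes, defines a morphism of coset semi-graphs OVER `𝔾`.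
This is the common shape of the transition maps (`f = id`, `K ≤ K'`) and of the deck
transformations (`f y = y g⁻¹`). [cite: MochizukiSemiAnbd2006, Thm 3.7(iii) p.41] -/
def mapOver (f : Γ → Γ)
    (hV : ∀ (w : 𝔾.Vertex) (y y' : Γ), DoubleCoset.mk (P.H w) K y = DoubleCoset.mk (P.H w) K y' →
      DoubleCoset.mk (P'.H w) K' (f y) = DoubleCoset.mk (P'.H w) K' (f y'))
    (hE : ∀ (e : 𝔾.Edge) (y y' : Γ), DoubleCoset.mk (P.M e) K y = DoubleCoset.mk (P.M e) K y' →
      DoubleCoset.mk (P'.M e) K' (f y) = DoubleCoset.mk (P'.M e) K' (f y'))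
    (hs : ∀ (b : 𝔾.Branch) (w : 𝔾.Vertex), 𝔾.abuts b = some w → ∀ y : Γ,
      DoubleCoset.mk (P'.H w) K' (f (P.s b * y)) = DoubleCoset.mk (P'.H w) K' (P'.s b * f y)) :
    P.cosetGraph K ⟶ P'.cosetGraph K' where
  vertexMap x := ⟨x.1, Quotient.liftOn' x.2 (fun y => DoubleCoset.mk (P'.H x.1) K' (f y))
    (fun y y' h => hV x.1 y y' (Quotient.sound' h))⟩
  edgeMap x := ⟨x.1, Quotient.liftOn' x.2 (fun y => DoubleCoset.mk (P'.M x.1) K' (f y))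
    (fun y y' h => hE x.1 y y' (Quotient.sound' h))⟩
  branchMap p := ⟨(p.1.1, ⟨p.1.2.1, Quotient.liftOn' p.1.2.2
    (fun y => DoubleCoset.mk (P'.M p.1.2.1) K' (f y)) (fun y y' h => hE _ y y' (Quotient.sound' h))⟩),
    p.2⟩
  edgeOf_branchMap _ := rfl
  branchMap_injOn := by
    rintro ⟨⟨b₁, E₁⟩, h₁⟩ ⟨⟨b₂, E₂⟩, h₂⟩ (hE : E₁ = E₂) h
    subst hE
    have hb : b₁ = b₂ := congrArg (fun p : (P'.cosetGraph K').Branch => p.1.1) h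
    subst hb
    rfl
  abuts_branchMap := by
    intro p x hx
    obtain ⟨b, y, rfl⟩ := P.bMk_surjective K p
    rcases hab : 𝔾.abuts b with _ | w
    · rw [P.cosetGraph_abuts_bMk_none K b hab y] at hx
      exact absurd hx (by simp)
    · rw [P.cosetGraph_abuts_bMk K b w hab y] at hx
      cases hx
      change (P'.cosetGraph K').abuts (P'.bMk K' b (f y)) = some (P'.vMk K' w (f (P.s b * y)))
      rw [P'.cosetGraph_abuts_bMk K' b w hab (f y)]
      exact congrArg (fun q : P'.VClass K' w => some (⟨w, q⟩ : (P'.cosetGraph K').Vertex))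
        (hs b w hab y).symm

/-- `mapOver` on vertex representatives. [cite: MochizukiSemiAnbd2006, Thm 3.7(iii) p.41] -/
@[simp] theorem mapOver_vertexMap_vMk (f : Γ → Γ) (hV hE hs) (w : 𝔾.Vertex) (y : Γ) :
    (mapOver (P := P) (K := K) (P' := P') (K' := K') f hV hE hs).vertexMap (P.vMk K w y) =
      P'.vMk K' w (f y) := rfl

/-- `mapOver` on edge representatives. [cite: MochizukiSemiAnbd2006, Thm 3.7(iii) p.41] -/
@[simp] theorem mapOver_edgeMap_eMk (f : Γ → Γ) (hV hE hs) (e : 𝔾.Edge) (y : Γ) :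
    (mapOver (P := P) (K := K) (P' := P') (K' := K') f hV hE hs).edgeMap (P.eMk K e y) =
      P'.eMk K' e (f y) := rfl

/-- `mapOver` on branch representatives. [cite: MochizukiSemiAnbd2006, Thm 3.7(iii) p.41] -/
@[simp] theorem mapOver_branchMap_bMk (f : Γ → Γ) (hV hE hs) (b : 𝔾.Branch) (y : Γ) :
    (mapOver (P := P) (K := K) (P' := P') (K' := K') f hV hE hs).branchMap (P.bMk K b y) =
      P'.bMk K' b (f y) := rfl

/-- `mapOver` is over `𝔾`. [cite: MochizukiSemiAnbd2006, Thm 3.7(iii) p.41] -/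
theorem mapOver_comp_proj (f : Γ → Γ) (hV hE hs) :
    mapOver (P := P) (K := K) (P' := P') (K' := K') f hV hE hs ≫ P'.cosetGraphProj K' =
      P.cosetGraphProj K := by
  refine SemiGraph.hom_ext _ _ ?_ ?_ ?_ <;> rfl

end Map

/-! ### Transition maps between levels -/

/-- **The transition morphism `P.cosetGraph K ⟶ P.cosetGraph K'` for `K ≤ K'`** (`y ↦ y`).
[cite: MochizukiSemiAnbd2006, Thm 3.7(iii) p.41] -/
def cosetGraphTrans {K K' : Subgroup Γ} (h : K ≤ K') : P.cosetGraph K ⟶ P.cosetGraph K' :=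
  mapOver id
    (fun w y y' hy => by
      obtain ⟨a, ha, k, hk, rfl⟩ := (DoubleCoset.eq _ _ _ _).mp hy
      exact (DoubleCoset.eq _ _ _ _).mpr ⟨a, ha, k, h hk, rfl⟩)
    (fun e y y' hy => by
      obtain ⟨a, ha, k, hk, rfl⟩ := (DoubleCoset.eq _ _ _ _).mp hy
      exact (DoubleCoset.eq _ _ _ _).mpr ⟨a, ha, k, h hk, rfl⟩)
    (fun _ _ _ _ => rfl)

/-- The transition morphism is over `𝔾`. [cite: MochizukiSemiAnbd2006, Thm 3.7(iii) p.41] -/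
theorem cosetGraphTrans_comp_proj {K K' : Subgroup Γ} (h : K ≤ K') :
    P.cosetGraphTrans h ≫ P.cosetGraphProj K' = P.cosetGraphProj K :=
  mapOver_comp_proj _ _ _ _

/-- Transition along `le_refl` is the identity. [cite: MochizukiSemiAnbd2006, Thm 3.7(iii) p.41] -/
theorem cosetGraphTrans_refl : P.cosetGraphTrans (le_refl K) = 𝟙 (P.cosetGraph K) :=
  P.hom_ext_mk K _ _ (fun _ _ => rfl) (fun _ _ => rfl) (fun _ _ => rfl)

/-- Transitions compose. [cite: MochizukiSemiAnbd2006, Thm 3.7(iii) p.41] -/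
theorem cosetGraphTrans_comp {K K' K'' : Subgroup Γ} (h : K ≤ K') (h' : K' ≤ K'') :
    P.cosetGraphTrans h ≫ P.cosetGraphTrans h' = P.cosetGraphTrans (h.trans h') :=
  P.hom_ext_mk K _ _ (fun _ _ => rfl) (fun _ _ => rfl) (fun _ _ => rfl)

/-! ### The deck action of `Γ` by right translation (normal level) -/

variable [K.Normal]

/-- Right translation by `g⁻¹` respects double cosets `L y K` for normal `K`. [folklore] -/
private theorem mk_mul_inv_eq_of_mk_eq (L : Subgroup Γ) (g : Γ) {y y' : Γ}
    (hy : DoubleCoset.mk L K y = DoubleCoset.mk L K y') :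
    DoubleCoset.mk L K (y * g⁻¹) = DoubleCoset.mk L K (y' * g⁻¹) := by
  obtain ⟨a, ha, k, hk, rfl⟩ := (DoubleCoset.eq _ _ _ _).mp hy
  refine (DoubleCoset.eq _ _ _ _).mpr ⟨a, ha, g * k * g⁻¹, Subgroup.Normal.conj_mem ‹K.Normal› k hk g, ?_⟩
  group

/-- The deck transformation of the level-`K` coset semi-graph by `g ∈ Γ`: right translation
`y ↦ y g⁻¹` of representatives (for NORMAL `K`). [cite: MochizukiSemiAnbd2006, Thm 3.7(iii) p.41] -/
def deckHom (g : Γ) : P.cosetGraph K ⟶ P.cosetGraph K :=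
  mapOver (fun y => y * g⁻¹)
    (fun w _ _ hy => mk_mul_inv_eq_of_mk_eq K (P.H w) g hy)
    (fun e _ _ hy => mk_mul_inv_eq_of_mk_eq K (P.M e) g hy)
    (fun _ _ _ y => by rw [mul_assoc])

/-- `deckHom 1 = 𝟙`. [cite: MochizukiSemiAnbd2006, Thm 3.7(iii) p.41] -/
theorem deckHom_one : P.deckHom K 1 = 𝟙 (P.cosetGraph K) :=
  P.hom_ext_mk K _ _ (fun _ _ => by simp [deckHom]) (fun _ _ => by simp [deckHom])
    (fun _ _ => by simp [deckHom])

/-- `deckHom (g * h) = deckHom h ≫ deckHom g`. [cite: MochizukiSemiAnbd2006, Thm 3.7(iii) p.41] -/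
theorem deckHom_mul (g h : Γ) : P.deckHom K (g * h) = P.deckHom K h ≫ P.deckHom K g :=
  P.hom_ext_mk K _ _ (fun _ _ => by simp [deckHom, mul_assoc])
    (fun _ _ => by simp [deckHom, mul_assoc]) (fun _ _ => by simp [deckHom, mul_assoc])

/-- **The deck action `Γ →* Aut (P.cosetGraph K)`** of `Γ` on the level-`K` coset semi-graph
(`K` normal), by right translation of representatives. [cite: MochizukiSemiAnbd2006, Thm 3.7(iii) p.41] -/
def deckAct : Γ →* Aut (P.cosetGraph K) where
  toFun g :=
    { hom := P.deckHom K g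
      inv := P.deckHom K g⁻¹
      hom_inv_id := by rw [← deckHom_mul, inv_mul_cancel, deckHom_one]
      inv_hom_id := by rw [← deckHom_mul, mul_inv_cancel, deckHom_one] }
  map_one' := by ext : 1; exact P.deckHom_one K
  map_mul' g h := by ext : 1; exact P.deckHom_mul K g h

/-- The deck action on vertex representatives: `H_w y K ↦ H_w y g⁻¹ K`.
[cite: MochizukiSemiAnbd2006, Thm 3.7(iii) p.41] -/
@[simp] theorem deckAct_vertexMap_vMk (g : Γ) (w : 𝔾.Vertex) (y : Γ) :
    (P.deckAct K g).hom.vertexMap (P.vMk K w y) = P.vMk K w (y * g⁻¹) := rfl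

/-- The deck action on edge representatives. [cite: MochizukiSemiAnbd2006, Thm 3.7(iii) p.41] -/
@[simp] theorem deckAct_edgeMap_eMk (g : Γ) (e : 𝔾.Edge) (y : Γ) :
    (P.deckAct K g).hom.edgeMap (P.eMk K e y) = P.eMk K e (y * g⁻¹) := rfl

/-- The deck action on branch representatives. [cite: MochizukiSemiAnbd2006, Thm 3.7(iii) p.41] -/
@[simp] theorem deckAct_branchMap_bMk (g : Γ) (b : 𝔾.Branch) (y : Γ) :
    (P.deckAct K g).hom.branchMap (P.bMk K b y) = P.bMk K b (y * g⁻¹) := rfl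

/-- The deck transformations are over `𝔾`. [cite: MochizukiSemiAnbd2006, Thm 3.7(iii) p.41] -/
theorem deckHom_comp_proj (g : Γ) : P.deckHom K g ≫ P.cosetGraphProj K = P.cosetGraphProj K :=
  mapOver_comp_proj _ _ _ _

/-- The deck action is over `𝔾`. [cite: MochizukiSemiAnbd2006, Thm 3.7(iii) p.41] -/
theorem deckAct_over (g : Γ) : (P.deckAct K g).hom ≫ P.cosetGraphProj K = P.cosetGraphProj K :=
  P.deckHom_comp_proj K g

omit [K.Normal] in
/-- The transition maps are equivariant for the deck actions.
[cite: MochizukiSemiAnbd2006, Thm 3.7(iii) p.41] -/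
theorem deckAct_trans {K K' : Subgroup Γ} [K.Normal] [K'.Normal] (h : K ≤ K') (g : Γ) :
    (P.deckAct K g).hom ≫ P.cosetGraphTrans h = P.cosetGraphTrans h ≫ (P.deckAct K' g).hom :=
  P.hom_ext_mk K _ _ (fun _ _ => rfl) (fun _ _ => rfl) (fun _ _ => rfl)

/-- Elements of `K` act trivially: the deck action factors through `Γ / K`.
[cite: MochizukiSemiAnbd2006, Thm 3.7(iii) p.41] -/
theorem deckAct_eq_one_of_mem {g : Γ} (hg : g ∈ K) : P.deckAct K g = 1 := by
  ext : 1
  refine P.hom_ext_mk K _ _ (fun w y => ?_) (fun e y => ?_) (fun b y => ?_)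
  · change P.vMk K w (y * g⁻¹) = P.vMk K w y
    exact congrArg (Sigma.mk w) ((DoubleCoset.eq _ _ _ _).mpr ⟨1, one_mem _, g, hg, by group⟩)
  · change P.eMk K e (y * g⁻¹) = P.eMk K e y
    exact congrArg (Sigma.mk e) ((DoubleCoset.eq _ _ _ _).mpr ⟨1, one_mem _, g, hg, by group⟩)
  · change P.bMk K b (y * g⁻¹) = P.bMk K b y
    have : DoubleCoset.mk (P.M (𝔾.edgeOf b)) K (y * g⁻¹) = DoubleCoset.mk (P.M (𝔾.edgeOf b)) K y :=
      (DoubleCoset.eq _ _ _ _).mpr ⟨1, one_mem _, g, hg, by group⟩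
    exact Subtype.ext (Prod.ext rfl (congrArg (Sigma.mk (𝔾.edgeOf b)) this))

/-- The kernel of the deck action contains `K`. [cite: MochizukiSemiAnbd2006, Thm 3.7(iii) p.41] -/
theorem le_ker_deckAct : K ≤ (P.deckAct K).ker := fun _ hg => P.deckAct_eq_one_of_mem K hg

end SubgroupPresentation

end SemiGraph

end Literature.AnabelianGeometry.SemiGraphs
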